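import Summits.AnomalousDissipation.AnomalousDissipation.Theorems.SolenoidalFractalHomogenisationLagrangianStepCellTimeModewise
import Summits.AnomalousDissipation.AnomalousDissipation.Theorems.SolenoidalFractalHomogenisationLagrangianStepModeCoeffContinuity
import Summits.AnomalousDissipation.AnomalousDissipation.Theorems.SolenoidalFractalHomogenisationLagrangianStepPairData
import Summits.AnomalousDissipation.AnomalousDissipation.Theorems.SolenoidalFractalHomogenisationLagrangianStepFlatBilinearAssembly
import Summits.AnomalousDissipation.AnomalousDissipation.Theorems.SolenoidalFractalHomogenisationLagrangianStepCellCorrectorContent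
import Literature.Analysis.FunctionSpaces.TorusGridCharacters
import HarnessLib

/-!
# K1L_D (stmt-AnomalousDissipation-27980), line «onelevel-design», brick Z4♭ — the COSINE bound at the window end and the grid sine witness
# (first half of the flat slow×slow window bound; helper; `--supports … --as helper`; lead-k1l-onelevel-p1 g4)

Composition of the lead's g4 bricks (memo L8 §2): for the FLAT pair (`Um1` = cell propagator along `E.level (m+1)` with `kbar(m+1)•S`, `Um` =
carrier-free effective propagator with `kbar m•renormStep (Φν) (gain/ν²) S`) of an `LPermissible` carrier replaying `W.stretch M`, a regime level
(`cellVisc(m+1) < ν₀`), the trim level `Lc` with `Lc < N(m+1)` and the scale separation `(Lc/2)·⌈K/ν⌉ ≤ N(m+1)`, a grid window `[j·r, s']`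
(`s' ≤ 1`), and ALL `x, y ∈ V2` supported on the slow set `S = freqBall(Lc/2)∖{0}`:

  `|⟪Um1 (jr) s' x − Um (jr) s' x, y⟫| ≤ Σ_{ℓ∈S} 2√2·err_ℓ(a(m+1)(s' − jr))·‖𝓕x(ℓ)‖·‖𝓕y(ℓ)‖`,

`err_ℓ` = the error function of `SlowVectorClauseF` (`…CellTimeModewise`).  Steps: (V) read on the window for unit cosine data
(`ae_modeCoeff_window_sub_sq_le`) → every window end (`…ModeCoeffContinuity` + `le_on_Icc_of_ae_le_of_continuousOn₂`) → all cosine data (scaling)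
→ all divergence-free pair data (`…PairData`, sine phase through the grid point `e_{i₀}/N`, `…PropagatorTranslate`) → all slow-supported data
(`…FlatBilinearAssembly`, class preservation `…PropagatorClass`, Leray `apply_eq_apply_starProjection`).
THIS FILE: the tools (`sum_norm_sq_modeCoeff_coe`, `integral_norm_sq_cosMode_le`, `im_mFourier_grid_ne_zero`) and the cosine bound at the window end
(`norm_fcoeff_window_sub_cos_unit_le`, `norm_fcoeff_window_sub_cos_le`); the assembly over slow modes rides in `…FlatBilinearWindow`, the template
bookkeeping and the text plumbing in `…FlatBilinearSlow`.
NOT a proof of any registered stub, of the crux, or of AD; rung F-D1.A0.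
-/

set_option linter.dupNamespace false  -- the summit-side namespace `Summit.AnomalousDissipation.AnomalousDissipation.…` repeats a component by design (D-0017)

noncomputable section

namespace Summit.AnomalousDissipation.AnomalousDissipation.Theorems.SolenoidalFractalHomogenisation.LagrangianStep.FlatWindow

open Literature.Analysis Literature.Analysis.FluidPDE Literature.Analysis.FluidPDE.Torus Literature.Analysis.FunctionSpaces
open MeasureTheory Set Filter UnitAddTorus Function Complex
open scoped ENNReal NNReal InnerProductSpace
open OneLevelSplit PropagatorSymm CellTime
open Literature.Analysis.FluidPDE.LatticeShear (LagrangianLatticeCarrier LatticeWord)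
open Summit.AnomalousDissipation.AnomalousDissipation.Theorems.SolenoidalFractalHomogenisation.LagrangianRenormalisationStep
  (cellVisc_pos' memLp_top_stLift_of_continuous continuous_uncurry_level)
open Summit.AnomalousDissipation.AnomalousDissipation.Theorems.SolenoidalFractalHomogenisation.PermissibleCarrier (isWeaklyDivFree_level)

variable {k : ℕ}

/-! ## Small tools -/

/-- `Σᵢ ‖modeCoeff ℓ (⇑z) i‖² = ‖𝓕z(ℓ)‖²` on `V2`. -/
theorem sum_norm_sq_modeCoeff_coe (ℓ : Fin 3 → ℤ) (z : V2) :
    ∑ i, ‖modeCoeff ℓ (z : VF) i‖ ^ 2 = ‖mFourierCoeff (EuclideanSpace.complexify ∘ ⇑z) ℓ‖ ^ 2 := by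
  rw [← sectorEnergy_eq (integrable_coe_V2 z)]; rfl

/-- `∫ ‖Re(e_ℓ x)•p‖² ≤ ‖p‖²`. -/
theorem integral_norm_sq_cosMode_le (ℓ : Fin 3 → ℤ) (p : EuclideanSpace ℝ (Fin 3)) :
    ∫ x : UnitAddTorus (Fin 3), ‖(mFourier ℓ x).re • p‖ ^ 2 ≤ ‖p‖ ^ 2 := by
  have hbd : ∀ x : UnitAddTorus (Fin 3), ‖(mFourier ℓ x).re • p‖ ^ 2 ≤ ‖p‖ ^ 2 := by
    intro x
    have h1 : |(mFourier ℓ x).re| ≤ 1 :=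
      (Complex.abs_re_le_norm _).trans ((ContinuousMap.norm_coe_le_norm (mFourier ℓ) x).trans (by rw [mFourier_norm]))
    rw [norm_smul, Real.norm_eq_abs, mul_pow]
    have h2 : |(mFourier ℓ x).re| ^ 2 ≤ 1 := pow_le_one₀ (abs_nonneg _) h1
    simpa using mul_le_mul_of_nonneg_right h2 (sq_nonneg ‖p‖)
  calc ∫ x : UnitAddTorus (Fin 3), ‖(mFourier ℓ x).re • p‖ ^ 2 ≤ ∫ _x : UnitAddTorus (Fin 3), ‖p‖ ^ 2 :=
        integral_mono_of_nonneg (ae_of_all _ fun x => by positivity) (integrable_const _) (ae_of_all _ hbd)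
    _ = ‖p‖ ^ 2 := by simp

/-- **A sine-phase witness on the grid**: for `ℓ` with a coordinate `i₀`, `0 < |2ℓ_{i₀}| < N`, the grid point `e_{i₀}/N` (index `jj` with
`jj i₀ = 1`, `jj i = 0` otherwise) has `Im e_ℓ ≠ 0`. -/
theorem im_mFourier_grid_ne_zero {N : ℕ} (hN : 0 < N) {ℓ : Fin 3 → ℤ} {i₀ : Fin 3} (hℓ0 : ℓ i₀ ≠ 0) (hsmall : 2 * |ℓ i₀| < N)
    (jj : Fin 3 → Fin N) (hjj0 : (jj i₀ : ℕ) = 1) (hjj : ∀ i, i ≠ i₀ → (jj i : ℕ) = 0) :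
    (mFourier ℓ (fun i => ((((jj i : ℕ) : ℝ) / N : ℝ) : UnitAddCircle))).im ≠ 0 := by
  rw [FunctionSpaces.Torus.mFourier_grid]
  -- the product collapses to the factor `i₀`
  have hprod : ∏ i : Fin 3, Complex.exp (2 * Real.pi * I * (ℓ i) * ((jj i : ℕ) : ℂ) / N)
      = Complex.exp (2 * Real.pi * I * (ℓ i₀) / N) := by
    rw [← Complex.exp_sum]
    congr 1
    rw [Finset.sum_eq_single i₀]
    · rw [hjj0]; push_cast; ring
    · intro i _ hi; rw [hjj i hi]; push_cast; ring
    · intro h; exact absurd (Finset.mem_univ i₀) h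
  rw [hprod, show (2 * Real.pi * I * (ℓ i₀ : ℂ) / N) = ((2 * Real.pi * (ℓ i₀ : ℝ) / N : ℝ) : ℂ) * I by push_cast; ring,
    Complex.exp_ofReal_mul_I_im]
  -- `sin (2π ℓ_{i₀}/N) ≠ 0` since `0 < |2ℓ_{i₀}/N| < 1`
  intro hsin
  rw [Real.sin_eq_zero_iff] at hsin
  obtain ⟨n, hn⟩ := hsin
  have hNr : (0:ℝ) < N := by exact_mod_cast hN
  have hnN : (n : ℝ) * N = 2 * (ℓ i₀ : ℝ) := by
    have hπ := Real.pi_pos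
    field_simp at hn
    nlinarith [hn, hπ]
  have habs : |(n : ℝ)| < 1 := by
    have h2 : |(n : ℝ)| * N < 1 * N := by
      rw [← abs_of_pos hNr, ← abs_mul, hnN, one_mul, abs_of_pos hNr, abs_mul, abs_two]
      exact_mod_cast hsmall
    exact lt_of_mul_lt_mul_right h2 hNr.le
  have hn0 : n = 0 := by
    have h' : |n| < 1 := by exact_mod_cast habs
    have h'' := abs_lt.1 h'
    omega
  rw [hn0, Int.cast_zero, zero_mul] at hnN
  have : (ℓ i₀ : ℝ) = 0 := by linarith
  exact hℓ0 (by exact_mod_cast this)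

/-! ## The cosine bound at the window end -/

/-- **Cosine data, unit polarisation, at the window end `s'`**: `‖𝓕(Um1 (jr) s' x_c(p) − Um (jr) s' x_c(p))(ℓ)‖ ≤ err_ℓ(a·(s' − jr))`. -/
theorem norm_fcoeff_window_sub_cos_unit_le (E : LagrangianLatticeCarrier k) (hL : E.LPermissible) {W : LatticeWord k} {M : ℝ} {hM : 0 < M}
    (hdes : E.design = W.stretch M hM) {c : ℝ} (hgain : E.gain = c) (m : ℕ)
    {Φ : ℝ → FluidPDE.Torus.Visc4 (Fin 3) → FluidPDE.Torus.Visc4 (Fin 3)} {lo hi Λ β σ C ν₀ K : ℝ}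
    (hV : SlowVectorClauseF W M hM c Φ lo hi Λ β σ C ν₀ K) (hΛ : 1 ≤ Λ) (hlo : 0 < lo) (hhi : lo ≤ hi) (hc : 0 < c) (hC : 0 ≤ C)
    (hν₀ : E.cellVisc (m + 1) < ν₀)
    {S : FluidPDE.Torus.Visc4 (Fin 3)} (hSo : FluidPDE.Torus.OddSmall S β) (hSn : FluidPDE.Torus.NearIso S lo hi)
    (hΦSn : FluidPDE.Torus.NearIso (Φ (E.cellVisc (m + 1)) S) lo hi)
    {Um Um1 : ℝ → ℝ → (V2 →L[ℝ] V2)}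
    (hUm : FluidPDE.Torus.IsPropagator 1 (fun (_ : ℝ) (_ : UnitAddTorus (Fin 3)) => (0 : EuclideanSpace ℝ (Fin 3)))
      (E.kbar m • renormStep (Φ (E.cellVisc (m + 1))) (E.gain / E.cellVisc (m + 1) ^ 2) S) Um)
    (hUm1 : FluidPDE.Torus.IsPropagator 1 (E.toFractalCarrierData.level (m + 1)) (E.kbar (m + 1) • S) Um1)
    (j : ℕ) {s' : ℝ} (h1 : (j : ℝ) * E.refresh (m + 1) < s') (h3 : s' ≤ 1)
    {ℓ : Fin 3 → ℤ} (hℓ : ℓ ≠ 0) (hscale : ‖Torus.latticeVec ℓ‖ * (⌈K / E.cellVisc (m + 1)⌉₊ : ℝ) ≤ E.N (m + 1))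
    {p : EuclideanSpace ℝ (Fin 3)} (hp : ‖p‖ = 1) (hpℓ : ⟪p, Torus.latticeVec ℓ⟫_ℝ = 0) :
    ‖mFourierCoeff (EuclideanSpace.complexify ∘ ⇑(Um1 ((j : ℝ) * E.refresh (m + 1)) s' ((memLp_cosMode ℓ p).toLp _)
        - Um ((j : ℝ) * E.refresh (m + 1)) s' ((memLp_cosMode ℓ p).toLp _))) ℓ‖
      ≤ (C * (C * (E.cellVisc (m + 1) ^ σ + (‖Torus.latticeVec ℓ‖ * (⌈K / E.cellVisc (m + 1)⌉₊ : ℝ) / E.N (m + 1)) ^ σ)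
              * min 1 ((8 * Real.pi ^ 2 * ‖Torus.latticeVec ℓ‖ ^ 2 * (hi * Λ) * (E.cellVisc (m + 1) + c / E.cellVisc (m + 1)) / (E.N (m + 1) : ℝ) ^ 2) * (E.a (m + 1) * (s' - (j : ℝ) * E.refresh (m + 1))))
            + (8 * Real.pi ^ 2 * ‖Torus.latticeVec ℓ‖ ^ 2 * (hi * Λ) * (E.cellVisc (m + 1) + c / E.cellVisc (m + 1)) / (E.N (m + 1) : ℝ) ^ 2)
              * (M * W.period / E.cellVisc (m + 1)))) := by
  set s : ℝ := (j : ℝ) * E.refresh (m + 1) with hs_def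
  set a : ℝ := E.a (m + 1) with ha_def
  have ha : 0 < a := E.a_pos (m + 1)
  have hs0 : 0 ≤ s := mul_nonneg (Nat.cast_nonneg _) (E.refresh_pos _).le
  have hs1 : s < 1 := lt_of_lt_of_le h1 h3
  have hLeq : (1 - s) / (1 / a) = (1 - s) * a := by rw [div_div_eq_mul_div, div_one]
  have hL0 : 0 < (1 - s) / (1 / a) := div_pos (by linarith) (one_div_pos.2 ha)
  set xd : V2 := (memLp_cosMode ℓ p).toLp _ with hxd
  -- (V) on the window, a.e. in cell time
  have hae := ae_modeCoeff_window_sub_sq_le E hL hdes hgain m hV hΛ hlo hν₀ hSo hSn hΦSn hUm hUm1 j rfl hs0 hs1 hℓ hscale hp hpℓ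
  -- both sides are continuous in cell time on `[0, (1−s)·a]`
  have hshift : ∀ t' ∈ Icc (0:ℝ) ((1 - s) / (1 / a)), s + 1 / a * t' ∈ Icc s 1 := by
    intro t' ht'
    have ht2 : t' ≤ (1 - s) * a := hLeq ▸ ht'.2
    have h2 : 1 / a * t' ≤ 1 - s :=
      calc 1 / a * t' ≤ 1 / a * ((1 - s) * a) := mul_le_mul_of_nonneg_left ht2 (one_div_pos.2 ha).le
        _ = 1 - s := by field_simp
    have h0 : 0 ≤ 1 / a * t' := mul_nonneg (one_div_pos.2 ha).le ht'.1
    exact ⟨by linarith, by linarith⟩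
  have hf : ContinuousOn (fun t' : ℝ => 2 * ∑ i, ‖modeCoeff ℓ
      ((Um1 s (s + 1 / a * t') xd - Um s (s + 1 / a * t') xd : V2) : VF) i‖ ^ 2) (Icc 0 ((1 - s) / (1 / a))) :=
    (continuousOn_sum_norm_sq_modeCoeff_propagator_sub hUm1 hUm hs0 hs1.le xd ℓ).comp
      ((continuous_const.add (continuous_const.mul continuous_id)).continuousOn) hshift
  have hg : ContinuousOn (fun t' : ℝ => (C * (C * (E.cellVisc (m + 1) ^ σ + (‖Torus.latticeVec ℓ‖ * (⌈K / E.cellVisc (m + 1)⌉₊ : ℝ) / E.N (m + 1)) ^ σ)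
              * min 1 ((8 * Real.pi ^ 2 * ‖Torus.latticeVec ℓ‖ ^ 2 * (hi * Λ) * (E.cellVisc (m + 1) + c / E.cellVisc (m + 1)) / (E.N (m + 1) : ℝ) ^ 2) * t')
            + (8 * Real.pi ^ 2 * ‖Torus.latticeVec ℓ‖ ^ 2 * (hi * Λ) * (E.cellVisc (m + 1) + c / E.cellVisc (m + 1)) / (E.N (m + 1) : ℝ) ^ 2)
              * (M * W.period / E.cellVisc (m + 1)))) ^ 2
      * ∫ x, ‖(UnitAddTorus.mFourier ℓ x).re • p‖ ^ 2) (Icc 0 ((1 - s) / (1 / a))) := by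
    refine ContinuousOn.mul (ContinuousOn.pow ?_ 2) continuousOn_const
    refine continuousOn_const.mul (ContinuousOn.add (continuousOn_const.mul ?_) continuousOn_const)
    exact (continuous_const.min (continuous_const.mul continuous_id)).continuousOn
  have hall := FluidPDE.Torus.le_on_Icc_of_ae_le_of_continuousOn₂ hL0 hf hg hae
  -- the window end in cell time
  have ht0 : a * (s' - s) ∈ Icc (0:ℝ) ((1 - s) / (1 / a)) := by
    rw [hLeq]
    constructor
    · exact mul_nonneg ha.le (by linarith)
    · rw [mul_comm (1 - s) a]
      exact mul_le_mul_of_nonneg_left (by linarith) ha.le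
  have key := hall _ ht0
  have es : s + 1 / a * (a * (s' - s)) = s' := by field_simp; ring
  simp only [es] at key
  rw [sum_norm_sq_modeCoeff_coe] at key
  -- `2‖𝓕‖² ≤ err²·∫‖d‖² ≤ err²`
  have herr0 : 0 ≤ (C * (C * (E.cellVisc (m + 1) ^ σ + (‖Torus.latticeVec ℓ‖ * (⌈K / E.cellVisc (m + 1)⌉₊ : ℝ) / E.N (m + 1)) ^ σ)
              * min 1 ((8 * Real.pi ^ 2 * ‖Torus.latticeVec ℓ‖ ^ 2 * (hi * Λ) * (E.cellVisc (m + 1) + c / E.cellVisc (m + 1)) / (E.N (m + 1) : ℝ) ^ 2) * (a * (s' - s)))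
            + (8 * Real.pi ^ 2 * ‖Torus.latticeVec ℓ‖ ^ 2 * (hi * Λ) * (E.cellVisc (m + 1) + c / E.cellVisc (m + 1)) / (E.N (m + 1) : ℝ) ^ 2)
              * (M * W.period / E.cellVisc (m + 1)))) := by
    have hν := cellVisc_pos' E.toFractalCarrierData (m + 1)
    have hsum : 0 < E.cellVisc (m + 1) + c / E.cellVisc (m + 1) := by positivity
    have hτ0 : 0 ≤ a * (s' - s) := mul_nonneg ha.le (by linarith)
    have hR : 0 ≤ 8 * Real.pi ^ 2 * ‖Torus.latticeVec ℓ‖ ^ 2 * (hi * Λ) * (E.cellVisc (m + 1) + c / E.cellVisc (m + 1))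
        / (E.N (m + 1) : ℝ) ^ 2 := by
      have : 0 ≤ hi := hlo.le.trans hhi
      positivity
    have hX : 0 ≤ E.cellVisc (m + 1) ^ σ + (‖Torus.latticeVec ℓ‖ * (⌈K / E.cellVisc (m + 1)⌉₊ : ℝ) / E.N (m + 1)) ^ σ := by positivity
    have hmin : 0 ≤ min 1 (8 * Real.pi ^ 2 * ‖Torus.latticeVec ℓ‖ ^ 2 * (hi * Λ) * (E.cellVisc (m + 1) + c / E.cellVisc (m + 1))
        / (E.N (m + 1) : ℝ) ^ 2 * (a * (s' - s))) := le_min zero_le_one (mul_nonneg hR hτ0)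
    have hP : 0 ≤ M * W.period / E.cellVisc (m + 1) := by
      have := PermissibleCarrier.period_pos W
      positivity
    exact mul_nonneg hC (add_nonneg (mul_nonneg (mul_nonneg hC hX) hmin) (mul_nonneg hR hP))
  have hint := integral_norm_sq_cosMode_le ℓ p
  rw [hp, one_pow] at hint
  have hsq : ‖mFourierCoeff (EuclideanSpace.complexify ∘ ⇑(Um1 s s' xd - Um s s' xd)) ℓ‖ ^ 2
      ≤ (C * (C * (E.cellVisc (m + 1) ^ σ + (‖Torus.latticeVec ℓ‖ * (⌈K / E.cellVisc (m + 1)⌉₊ : ℝ) / E.N (m + 1)) ^ σ)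
              * min 1 ((8 * Real.pi ^ 2 * ‖Torus.latticeVec ℓ‖ ^ 2 * (hi * Λ) * (E.cellVisc (m + 1) + c / E.cellVisc (m + 1)) / (E.N (m + 1) : ℝ) ^ 2) * (a * (s' - s)))
            + (8 * Real.pi ^ 2 * ‖Torus.latticeVec ℓ‖ ^ 2 * (hi * Λ) * (E.cellVisc (m + 1) + c / E.cellVisc (m + 1)) / (E.N (m + 1) : ℝ) ^ 2)
              * (M * W.period / E.cellVisc (m + 1)))) ^ 2 := by
    have hmono := mul_le_mul_of_nonneg_left hint (sq_nonneg ((C * (C * (E.cellVisc (m + 1) ^ σ + (‖Torus.latticeVec ℓ‖ * (⌈K / E.cellVisc (m + 1)⌉₊ : ℝ) / E.N (m + 1)) ^ σ)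
              * min 1 ((8 * Real.pi ^ 2 * ‖Torus.latticeVec ℓ‖ ^ 2 * (hi * Λ) * (E.cellVisc (m + 1) + c / E.cellVisc (m + 1)) / (E.N (m + 1) : ℝ) ^ 2) * (a * (s' - s)))
            + (8 * Real.pi ^ 2 * ‖Torus.latticeVec ℓ‖ ^ 2 * (hi * Λ) * (E.cellVisc (m + 1) + c / E.cellVisc (m + 1)) / (E.N (m + 1) : ℝ) ^ 2)
              * (M * W.period / E.cellVisc (m + 1))))))
    nlinarith [key, hmono, sq_nonneg ‖mFourierCoeff (EuclideanSpace.complexify ∘ ⇑(Um1 s s' xd - Um s s' xd)) ℓ‖]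
  exact (pow_le_pow_iff_left₀ (norm_nonneg _) herr0 (by norm_num : (2:ℕ) ≠ 0)).1 hsq

/-- **Cosine data, any polarisation `p ⊥ ℓ`** (scaling). -/
theorem norm_fcoeff_window_sub_cos_le (E : LagrangianLatticeCarrier k) (hL : E.LPermissible) {W : LatticeWord k} {M : ℝ} {hM : 0 < M}
    (hdes : E.design = W.stretch M hM) {c : ℝ} (hgain : E.gain = c) (m : ℕ)
    {Φ : ℝ → FluidPDE.Torus.Visc4 (Fin 3) → FluidPDE.Torus.Visc4 (Fin 3)} {lo hi Λ β σ C ν₀ K : ℝ}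
    (hV : SlowVectorClauseF W M hM c Φ lo hi Λ β σ C ν₀ K) (hΛ : 1 ≤ Λ) (hlo : 0 < lo) (hhi : lo ≤ hi) (hc : 0 < c) (hC : 0 ≤ C)
    (hν₀ : E.cellVisc (m + 1) < ν₀)
    {S : FluidPDE.Torus.Visc4 (Fin 3)} (hSo : FluidPDE.Torus.OddSmall S β) (hSn : FluidPDE.Torus.NearIso S lo hi)
    (hΦSn : FluidPDE.Torus.NearIso (Φ (E.cellVisc (m + 1)) S) lo hi)
    {Um Um1 : ℝ → ℝ → (V2 →L[ℝ] V2)}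
    (hUm : FluidPDE.Torus.IsPropagator 1 (fun (_ : ℝ) (_ : UnitAddTorus (Fin 3)) => (0 : EuclideanSpace ℝ (Fin 3)))
      (E.kbar m • renormStep (Φ (E.cellVisc (m + 1))) (E.gain / E.cellVisc (m + 1) ^ 2) S) Um)
    (hUm1 : FluidPDE.Torus.IsPropagator 1 (E.toFractalCarrierData.level (m + 1)) (E.kbar (m + 1) • S) Um1)
    (j : ℕ) {s' : ℝ} (h1 : (j : ℝ) * E.refresh (m + 1) < s') (h3 : s' ≤ 1)
    {ℓ : Fin 3 → ℤ} (hℓ : ℓ ≠ 0) (hscale : ‖Torus.latticeVec ℓ‖ * (⌈K / E.cellVisc (m + 1)⌉₊ : ℝ) ≤ E.N (m + 1))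
    (p : EuclideanSpace ℝ (Fin 3)) (hpℓ : ⟪p, Torus.latticeVec ℓ⟫_ℝ = 0) :
    ‖mFourierCoeff (EuclideanSpace.complexify ∘ ⇑(Um1 ((j : ℝ) * E.refresh (m + 1)) s' ((memLp_cosMode ℓ p).toLp _)
        - Um ((j : ℝ) * E.refresh (m + 1)) s' ((memLp_cosMode ℓ p).toLp _))) ℓ‖
      ≤ (C * (C * (E.cellVisc (m + 1) ^ σ + (‖Torus.latticeVec ℓ‖ * (⌈K / E.cellVisc (m + 1)⌉₊ : ℝ) / E.N (m + 1)) ^ σ)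
              * min 1 ((8 * Real.pi ^ 2 * ‖Torus.latticeVec ℓ‖ ^ 2 * (hi * Λ) * (E.cellVisc (m + 1) + c / E.cellVisc (m + 1)) / (E.N (m + 1) : ℝ) ^ 2) * (E.a (m + 1) * (s' - (j : ℝ) * E.refresh (m + 1))))
            + (8 * Real.pi ^ 2 * ‖Torus.latticeVec ℓ‖ ^ 2 * (hi * Λ) * (E.cellVisc (m + 1) + c / E.cellVisc (m + 1)) / (E.N (m + 1) : ℝ) ^ 2)
              * (M * W.period / E.cellVisc (m + 1)))) * ‖p‖ := by
  by_cases hp0 : p = 0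
  · subst hp0
    have h0 : (memLp_cosMode ℓ (0 : EuclideanSpace ℝ (Fin 3))).toLp _ = (0 : V2) := by
      refine Lp.ext ((MemLp.coeFn_toLp _).trans ?_)
      filter_upwards [Lp.coeFn_zero (EuclideanSpace ℝ (Fin 3)) 2 volume] with x hx
      rw [hx, smul_zero]; rfl
    rw [h0, map_zero, map_zero, sub_zero, fcoeff_zero, norm_zero, norm_zero, mul_zero]
  · have hnp : 0 < ‖p‖ := norm_pos_iff.2 hp0
    set u : EuclideanSpace ℝ (Fin 3) := (1 / ‖p‖) • p with hu
    have hun : ‖u‖ = 1 := by rw [hu, norm_smul, Real.norm_eq_abs, abs_of_pos (by positivity)]; field_simp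
    have huℓ : ⟪u, Torus.latticeVec ℓ⟫_ℝ = 0 := by rw [hu, real_inner_smul_left, hpℓ, mul_zero]
    have hxp : (memLp_cosMode ℓ p).toLp _ = ‖p‖ • (memLp_cosMode ℓ u).toLp _ := by
      rw [← MemLp.toLp_const_smul]
      refine MemLp.toLp_congr _ _ (Filter.Eventually.of_forall fun x => ?_)
      simp only [Pi.smul_apply, hu, smul_smul]
      rw [show ‖p‖ * ((mFourier ℓ x).re * (1 / ‖p‖)) = (mFourier ℓ x).re by field_simp]
    rw [hxp, map_smul, map_smul, ← smul_sub, fcoeff_smul, norm_smul, Complex.norm_real, Real.norm_eq_abs, abs_of_pos hnp, mul_comm]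
    exact mul_le_mul_of_nonneg_right
      (norm_fcoeff_window_sub_cos_unit_le E hL hdes hgain m hV hΛ hlo hhi hc hC hν₀ hSo hSn hΦSn hUm hUm1 j h1 h3 hℓ hscale hun huℓ) hnp.le

end Summit.AnomalousDissipation.AnomalousDissipation.Theorems.SolenoidalFractalHomogenisation.LagrangianStep.FlatWindow

end
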